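import Summits.CriticalPhenomena.PercolationContinuityZ3.Theses.PercLowPointHalfSpace
import Summits.CriticalPhenomena.PercolationContinuityZ3.Theorems.TallClusterMassBound.Negative.MassExponentFamily
import Summits.CriticalPhenomena.PercolationContinuityZ3.Theorems.TallClusterMassBound.Negative.FalseWithoutCriticality
import Summits.CriticalPhenomena.PercolationContinuityZ3.Theorems.PercLowPointHalfSpaceTallClusterMassBoundWallArmPartial
import Summits.CriticalPhenomena.PercolationContinuityZ3.Theorems.PercLowPointHalfSpaceTallClusterMassBoundAccessibleDefs
import Summits.CriticalPhenomena.PercolationContinuityZ3.Theorems.PercLowPointHalfSpaceTallClusterMassBoundStubAccTwoArm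
import Summits.CriticalPhenomena.PercolationContinuityZ3.Theorems.PercLowPointHalfSpaceTallClusterMassBoundStubSkeletonSum

/-!
# Line `Sketch` (= crux idea `accessible-skeleton-overhang`) — checked skeleton for crux `TallClusterMassBound`
(stmt-CriticalPhenomena-0912, route PercLowPointHalfSpace, item B; line lead a1, cycle 1)

Crux (by name): `Summit.CriticalPhenomena.PercolationContinuityZ3.Theses.PercLowPointHalfSpace.TallClusterMassBound`
`= MassBoundAt p_c (11/4)` (`Negative.tallClusterMassBound_iff`, `Iff.rfl`):
`M(r) := Σ_{x ∈ B_r} P(0 ↔_ℍ x, arm_ℍ(0,r)) ≤ C r^{11/4} π_s(r)`, `π_s(r) := P(arm_ℍ(0,r))`, at `p_c(ℤ³)`.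

IDEA (card `Ideas/accessible-skeleton-overhang.md`, sketch `SketchIdeator2.lean`): filter the half-space cluster
`U = C_ℍ(0)` by minimax height. A point `x ∈ U` is ACCESSIBLE iff `0 ↔ x` inside the slab `S_{x₀} = {0 ≤ y₀ ≤ x₀}`
(`acc x`); otherwise it is an OVERHANG point (reached only through an excursion above its own level). Then
`M(r) ≤ Σ_x P(acc x ∩ arm_r) + Σ_x P((conn x ∖ acc x) ∩ arm_r)` (union bound), and:

* `stub_accTwoArm` (PROVABLE NOW; the card's skeleton bound (A), pointwise): an accessible point is DOUBLY
  wall-rooted — `P_p(acc x) ≤ π_p(k)²` whenever `2k+1 ≤ ‖x‖∞`: the slab path from `0` to `x` first leaves `Λ_k`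
  (a wall arm to distance `k`, edges of `Λ_k`) and, read backwards from `x`, first leaves `x + Λ_k` inside the
  slab (edges of `x + Λ_k`, disjoint from `Λ_k` since `‖x‖∞ ≥ 2k+1`); independence
  (`DCT16.real_inter_of_determinedBy_disjoint`), and the slab reflection `y ↦ (x₀ - y₀, y₁ - x₁, y₂ - x₂)` =
  `faceIso x 0 (-1)` maps the second event into a wall arm from `0` (`bondPercolation_real_preimage_relabel_iso`),
  because `y₀ ≤ x₀` on the slab. Template: `Theorems/…BulkWallArmProduct.lean`.
* `stub_skeletonSum` (PROVABLE NOW; pure bookkeeping): any `f : ℤ³ → [0,1]` with `f x ≤ π(k)²` for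
  `2k+1 ≤ ‖x‖∞` and `π(k) ≤ C₀ k^{-a}` (`0 < a ≤ 1`) has `Σ_{x ∈ B_r} f x ≤ C r^{3-2a}`.
* `stub_wallArmTwoSided` (OPEN — the card's `Leans on`: crux C `QuantitativeBGN` WITH its rate, in two-sided
  form): `c r^{-b} ≤ π_s(r) ≤ C₀ r^{-a}` with `b + 1/4 ≤ 2a` (numerically `a = b = x_s ≈ 0.975`, Deng–Blöte 2005;
  `b + 1/4 = 1.23 ≤ 1.95`). Contains `QuantitativeBGNWith a` for some `a ≥ 1/8`; the lower side is provable
  today only with `b = 2` (`armProb_criticalProbI_ge`), which would force `a ≥ 9/8 > x_s` — so BOTH sides are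
  genuinely needed at their conjectured strength (triage r1-1/2/3 "sharpen").
* `stub_overhangMassBound` (HARDEST — B's residue inside this line; the lead's stub): the overhang points of a
  tall wall cluster number `≤ C r^{11/4}` on average: `Σ_{x ∈ B_r} P((conn x ∖ acc x) ∩ arm_r) ≤ C r^{11/4} π_s(r)`.
  Given the other three stubs it is EQUIVALENT to the crux (overhang ≤ total ≤ overhang + skeleton); its only
  structural handle is the generation recursion (card (B)): generation `h` = clusters, in `S_h ∖ Ũ_{h-1}`, of the
  seeds above open up-edges of the top layer `D_{h-1}`, dominated given the past by FRESH ceiling-rooted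
  (= wall-rooted, by reflection) slab clusters.
* `TallClusterMassBound_of` (PROVED from the four stubs, no sorry): `accessibleMass_le` (stubs 1–3 ⇒
  `Σ_x P(acc x ∩ arm_r) ≤ C r^{11/4} π_s(r)`, via `r^{3-2a} ≤ r^{11/4-b} ≤ c⁻¹ r^{11/4} π_s(r)`) + stub 4 +
  the union bound.

DISPROOF USED (`Cruxes/TallClusterMassBound/Disproof.lean`, cdisprove gen 1, NO KILL; landed Negative modules imported):
`tallClusterMassBound_false_without_criticality` (¬`MassBoundAt 1 (11/4)`) — honoured: at `p = 1`, `π_s ≡ 1`, so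
`stub_wallArmTwoSided` is false there (no rate `a > 0`), while `stub_overhangMassBound` holds there VACUOUSLY (all
edges open ⇒ every point of the half box is accessible along the wall and up its column, the overhang sum is `0`): at
`p = 1` the failure of B sits entirely in the rate stub and in (A) (the accessible mass is the full half-box `≍ r³`);
at `p_c` in a jump world `θ(p_c) > 0` with wall rate `a ≥ 1/4` it is `stub_overhangMassBound` that fails (dense
overhangs), with `a < 1/4` it is `stub_wallArmTwoSided` — the split does not localise criticality in one stub;
`not_densityBoundAt_criticalProbI` (no uniform density bound, `ρ_r(0) = 1`) — all four stubs are averaged over `B_r`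
or pointwise-in-`x` with `‖x‖∞ ≥ 3`, and the root/near-root terms are absorbed by `stub_skeletonSum`'s constant;
`succ_mul_armProb_le_mass` (`m ≥ 1`) respected; `massBoundAt_three` (exponent 3 free) is what (A) alone gives without a
rate. `-- Targets`: none yet for this line. Negatives index (`ledger negatives`): nothing on slab clusters / accessible
sets (triage r1-1/2/3 concur).
-/

noncomputable section

open MeasureTheory Finset Filter
open Literature.Probability.Percolation Literature.Probability.LatticeModels
open Summit.CriticalPhenomena.PercolationContinuityZ3.Theses.PercLowPointHalfSpace (TallClusterMassBound)
open Summit.CriticalPhenomena.PercolationContinuityZ3.Theorems.TallClusterMassBound.Negative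
open Summit.CriticalPhenomena.PercolationContinuityZ3.Theorems.TallClusterMassBound.AccessibleSkeleton

namespace Summit.CriticalPhenomena.PercolationContinuityZ3.Cruxes.TallClusterMassBound.AccessibleSkeleton

/-! ## Vocabulary of the line

Landed, importable (`Theorems/TallClusterMassBound/Negative/MassExponentFamily.lean`): `V3 = Site 3`,
`Hs = {x | 0 ≤ x 0}`, `Pp p = bondPercolation (zdGraph 3) p`, `conn x = openConnIn Hs 0 x`,
`arm r = {ω | ∃ y, (∃ i, r ≤ |y i|) ∧ ω ∈ openConnIn Hs 0 y}` (verbatim the route's tall event),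
`armProb p r = (Pp p).real (arm r)`, `mass p r = Σ_{x ∈ box 3 r} (Pp p).real (conn x ∩ arm r)`, `MassBoundAt p s`,
`snorm z = max (max |z 0| |z 1|) |z 2|` (sup-norm, `mem_box_iff_snorm`). New here: `slab`, `acc`. -/

-- `slab`, `acc`: LANDED (p96113) in `Theorems/PercLowPointHalfSpaceTallClusterMassBoundAccessibleDefs.lean`
-- (namespace `…Theorems.TallClusterMassBound.AccessibleSkeleton`, opened above): `slab h = {y | 0 ≤ y 0 ∧ y 0 ≤ h}`,
-- `acc x = openConnIn (slab (x 0)) 0 x`.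

/-! ## The four registered stubs -/

-- STUB 1 `stub_accTwoArm` — LANDED (wave 1, p97926): `Theorems/PercLowPointHalfSpaceTallClusterMassBoundStubAccTwoArm.lean`,
-- `theorem stub_accTwoArm : ∀ (p : unitInterval) (k : ℕ) (x : V3), 2 * k + 1 ≤ snorm x → (Pp p).real (acc x) ≤ armProb p k ^ 2`
-- (first exit from `Λ_k` + first exit of the reversed slab path from `x + Λ_k`, disjoint supports for `‖x‖∞ ≥ 2k+1`,
-- `DCT16.real_inter_of_determinedBy_disjoint`, slab reflection `faceIso x 0 (-1)`). Used below by name.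

-- STUB 2 `stub_skeletonSum` — LANDED (wave 1, p99237): `Theorems/PercLowPointHalfSpaceTallClusterMassBoundStubSkeletonSum.lean`,
-- `theorem stub_skeletonSum : ∀ (a C₀ : ℝ), 0 < a → a ≤ 1 → 0 ≤ C₀ → ∃ C, ∀ f π, … → ∀ r ≥ 1, ∑ x ∈ box 3 r, f x ≤ C * r ^ (3 - 2a)`
-- (pointwise `f x ≤ K r^{2-2a} ‖x‖∞⁻²` + the lattice sum `Σ_{B_r} ‖x‖∞⁻² ≤ 26 r`; `C = 1 + 26 (4 + 16 C₀²)`). Used below by name.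

/-- **STUB 3 — two-sided power law for the wall one-arm at `p_c(ℤ³)` with `b + 1/4 ≤ 2a` (OPEN; the line's
`Leans on`).** There are exponents `0 < a ≤ 1`, `b`, and constants with `c r^{-b} ≤ π_s(r) ≤ C₀ r^{-a}` for all
`r ≥ 1` and `b + 1/4 ≤ 2a`. The upper side is crux C (`QuantitativeBGN`) with an explicit rate (it needs `a ≥ 1/8`
at the very least, and `a ≥ (b + 1/4)/2 ≥ (a + 1/4)/2`, i.e. `a ≥ 1/4`, since `b ≥ a`); the lower side is a wall-arm
LOWER bound sharper than the landed `π_s(r) ≥ 1/(588 r²)` (`armProb_criticalProbI_ge`, `b = 2`, which would force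
`a ≥ 9/8`, false numerically; improving `b` below `2` through the only known route, the product floor
`π(a) π_s(a) ≥ c/a²` of `bulkArm_mul_wallArm_lower`, needs a bulk one-arm upper RATE at `p_c(ℤ³)` — summit-adjacent).
Numerics: `a = b = x_s ≈ 0.975` (Deng–Blöte 2005; in-project MC slopes −0.94…−1.02, kit j010987/j000789), margin
`2a - b - 1/4 ≈ 0.72`. False at `p = 1` (`π_s ≡ 1`, no `a > 0`) and for `p < p_c` (exponential decay, no power lower
bound): uses `p = p_c` exactly, from both sides. WAVE 1 (worker W-two): `stub-blocked:
Summit.CriticalPhenomena.PercolationContinuityZ3.Theses.PercLowPointHalfSpace.QuantitativeBGN` (needed with `a ≥ 1/4` and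
`b ≤ 2a − 1/4 ≤ 7/4`; tree: `b = 2` only, no `a`). Size: XL (open; ⊇ crux C with rate). -/
theorem stub_wallArmTwoSided :
    ∃ a b C₀ c : ℝ, 0 < a ∧ a ≤ 1 ∧ 0 < c ∧ b + 1 / 4 ≤ 2 * a ∧
      (∀ r : ℕ, 1 ≤ r → armProb (criticalProbI 3) r ≤ C₀ * (r : ℝ) ^ (-a)) ∧
      (∀ r : ℕ, 1 ≤ r → c * (r : ℝ) ^ (-b) ≤ armProb (criticalProbI 3) r) := by
  sorry

/-- **STUB 4 (hardest; the lead's) — overhang mass bound.** At `p_c(ℤ³)`: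
`Σ_{x ∈ B_r} P((0 ↔_ℍ x) ∖ (acc x), arm_ℍ(0,r)) ≤ C r^{11/4} π_s(r)` — the points of a tall wall cluster that are
reached only through an excursion ABOVE their own level number `≤ C r^{11/4}` on average given tall.
Heuristically the overhangs carry the whole anomalous dimension (`≍ r^{d_f} = r^{2.52}` given tall, MC mass|tall slopes
2.4–2.5 vs acc|tall 1.9–2.0, card/kit j009137), margin `0.23` = B's margin; given stubs 1–3 this stub is EQUIVALENT
to the crux (overhang ≤ total ≤ overhang + skeleton), so it is exactly as hard as B and is violated exactly in the
jump world `θ(p_c) > 0` (dense wall clusters). Structural handle (card (B)): generation recursion + fresh-configuration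
domination of each generation by wall-rooted slab clusters; known engines dead (first moment over seeds × slab
susceptibility: `r^{2.6}` unconditional vs needed `r^{1.775}`, Findings-ideator2 §2). Size: XL (open, crux-strength). -/
theorem stub_overhangMassBound :
    ∃ C : ℝ, ∀ r : ℕ, 1 ≤ r →
      ∑ x ∈ box 3 r, (Pp (criticalProbI 3)).real ((conn x \ acc x) ∩ arm r) ≤
        C * (r : ℝ) ^ ((11 : ℝ) / 4) * armProb (criticalProbI 3) r := by
  sorry

/-! ## Composition (all proved)

The same composition is LANDED with the two open stubs as explicit hypotheses (glue p101914,
`Theorems/PercLowPointHalfSpaceTallClusterMassBoundAccessibleGlue.lean`, namespace `…Theorems.TallClusterMassBound.AccessibleSkeleton`):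
`accessibleSum_le_of_rate` (stubs 1–2 ⇒ for EVERY `p`, a wall one-arm rate `a` gives `Σ_{B_r} P_p(acc x) ≤ C r^{3-2a}` — the
card's `AccessibleFromBoundaryRate`), `accessibleMass_le_of_twoSided`, `massBoundAt_of_accessible_of_overhang`, and the registered
closed sub-goal `tallClusterMassBound_of_wallArmTwoSided_of_overhangMassBound : (stub 3) → (stub 4) → TallClusterMassBound`.
The proofs are repeated here (prefixed `sk_`) only so that this workfile elaborates independently of that module's olean. -/

/-- `P(acc x ∩ arm r) ≤ P(acc x)`. [folklore] -/
theorem sk_real_acc_inter_arm_le (p : unitInterval) (x : V3) (r : ℕ) :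
    (Pp p).real (acc x ∩ arm r) ≤ (Pp p).real (acc x) :=
  measureReal_mono Set.inter_subset_left

/-- `P(acc x) ≤ 1`. [folklore] -/
theorem sk_real_acc_le_one (p : unitInterval) (x : V3) : (Pp p).real (acc x) ≤ 1 := measureReal_le_one

/-- **Stubs 1–3 ⇒ the accessible (skeleton) mass bound**: `Σ_{x ∈ B_r} P(acc x ∩ arm_r) ≤ C r^{11/4} π_s(r)`.
Drop `arm_r`, apply stub 2 to `f = P(acc ·)`, `π = π_s` (stub 1 = the pointwise hypothesis, stub 3's upper side = the
rate), then `r^{3-2a} ≤ r^{11/4-b} ≤ c⁻¹ r^{11/4} π_s(r)` by stub 3's lower side and `b + 1/4 ≤ 2a`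
(= landed `accessibleMass_le_of_twoSided` fed with `stub_wallArmTwoSided`). [folklore] -/
theorem accessibleMass_le :
    ∃ C : ℝ, ∀ r : ℕ, 1 ≤ r →
      ∑ x ∈ box 3 r, (Pp (criticalProbI 3)).real (acc x ∩ arm r) ≤
        C * (r : ℝ) ^ ((11 : ℝ) / 4) * armProb (criticalProbI 3) r := by
  obtain ⟨a, b, C₀, c, ha, ha1, hc, hab, hup, hlow⟩ := stub_wallArmTwoSided
  have hC₀ : 0 ≤ C₀ := by
    have h1 := hup 1 le_rfl
    have hπ := armProb_nonneg (criticalProbI 3) 1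
    simp only [Nat.cast_one, Real.one_rpow, mul_one] at h1
    linarith
  obtain ⟨C, hCsum⟩ := stub_skeletonSum a C₀ ha ha1 hC₀
  have hsum := hCsum (fun x => (Pp (criticalProbI 3)).real (acc x)) (armProb (criticalProbI 3))
    (fun x => measureReal_nonneg) (fun x => sk_real_acc_le_one _ x) (fun k => armProb_nonneg _ k)
    (fun k x _ hkx => stub_accTwoArm (criticalProbI 3) k x hkx) hup
  refine ⟨max C 0 / c, fun r hr => ?_⟩
  have hr0 : (0 : ℝ) < r := by exact_mod_cast hr
  have hr1 : (1 : ℝ) ≤ r := by exact_mod_cast hr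
  have hπ := hlow r hr
  have h1 : ∑ x ∈ box 3 r, (Pp (criticalProbI 3)).real (acc x ∩ arm r) ≤ max C 0 * (r : ℝ) ^ ((11 : ℝ) / 4 - b) := by
    calc ∑ x ∈ box 3 r, (Pp (criticalProbI 3)).real (acc x ∩ arm r)
        ≤ ∑ x ∈ box 3 r, (Pp (criticalProbI 3)).real (acc x) :=
          Finset.sum_le_sum fun x _ => sk_real_acc_inter_arm_le _ x r
      _ ≤ C * (r : ℝ) ^ (3 - 2 * a) := hsum r hr
      _ ≤ max C 0 * (r : ℝ) ^ (3 - 2 * a) :=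
          mul_le_mul_of_nonneg_right (le_max_left _ _) (Real.rpow_nonneg hr0.le _)
      _ ≤ max C 0 * (r : ℝ) ^ ((11 : ℝ) / 4 - b) :=
          mul_le_mul_of_nonneg_left (Real.rpow_le_rpow_of_exponent_le hr1 (by linarith)) (le_max_right _ _)
  have h2 : (r : ℝ) ^ ((11 : ℝ) / 4 - b) ≤ (r : ℝ) ^ ((11 : ℝ) / 4) * armProb (criticalProbI 3) r / c := by
    rw [Real.rpow_sub hr0, div_eq_mul_inv, le_div_iff₀ hc]
    have hneg : ((r : ℝ) ^ b)⁻¹ = (r : ℝ) ^ (-b) := by rw [Real.rpow_neg hr0.le]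
    rw [hneg]
    calc (r : ℝ) ^ ((11 : ℝ) / 4) * (r : ℝ) ^ (-b) * c = (r : ℝ) ^ ((11 : ℝ) / 4) * (c * (r : ℝ) ^ (-b)) := by ring
      _ ≤ (r : ℝ) ^ ((11 : ℝ) / 4) * armProb (criticalProbI 3) r :=
          mul_le_mul_of_nonneg_left hπ (Real.rpow_nonneg hr0.le _)
  calc ∑ x ∈ box 3 r, (Pp (criticalProbI 3)).real (acc x ∩ arm r)
      ≤ max C 0 * (r : ℝ) ^ ((11 : ℝ) / 4 - b) := h1
    _ ≤ max C 0 * ((r : ℝ) ^ ((11 : ℝ) / 4) * armProb (criticalProbI 3) r / c) :=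
        mul_le_mul_of_nonneg_left h2 (le_max_right _ _)
    _ = max C 0 / c * (r : ℝ) ^ ((11 : ℝ) / 4) * armProb (criticalProbI 3) r := by ring

/-- The union bound `P(conn x ∩ arm_r) ≤ P(acc x ∩ arm_r) + P((conn x ∖ acc x) ∩ arm_r)`. [folklore] -/
theorem sk_real_conn_inter_arm_le_acc_add_overhang (p : unitInterval) (x : V3) (r : ℕ) :
    (Pp p).real (conn x ∩ arm r) ≤ (Pp p).real (acc x ∩ arm r) + (Pp p).real ((conn x \ acc x) ∩ arm r) := by
  refine le_trans (measureReal_mono ?_) (measureReal_union_le _ _)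
  intro ω hω
  by_cases h : ω ∈ acc x
  · exact Or.inl ⟨h, hω.2⟩
  · exact Or.inr ⟨⟨hω.1, h⟩, hω.2⟩

/-- Skeleton + overhang ⇒ `MassBoundAt p_c (11/4)` (constants add; = landed `massBoundAt_of_accessible_of_overhang`). Stated on
`MassBoundAt` so that exactly ONE theorem of this file (`TallClusterMassBound_of`) concludes the crux by name. [folklore] -/
theorem sk_massBoundAt_of_accessible_of_overhang {CA CO : ℝ}
    (hA : ∀ r : ℕ, 1 ≤ r → ∑ x ∈ box 3 r, (Pp (criticalProbI 3)).real (acc x ∩ arm r) ≤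
      CA * (r : ℝ) ^ ((11 : ℝ) / 4) * armProb (criticalProbI 3) r)
    (hO : ∀ r : ℕ, 1 ≤ r → ∑ x ∈ box 3 r, (Pp (criticalProbI 3)).real ((conn x \ acc x) ∩ arm r) ≤
      CO * (r : ℝ) ^ ((11 : ℝ) / 4) * armProb (criticalProbI 3) r) :
    MassBoundAt (criticalProbI 3) ((11 : ℝ) / 4) := by
  refine ⟨CA + CO, fun r hr => ?_⟩
  unfold mass
  calc ∑ x ∈ box 3 r, (Pp (criticalProbI 3)).real (conn x ∩ arm r)
      ≤ ∑ x ∈ box 3 r, ((Pp (criticalProbI 3)).real (acc x ∩ arm r) +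
          (Pp (criticalProbI 3)).real ((conn x \ acc x) ∩ arm r)) :=
        Finset.sum_le_sum fun x _ => sk_real_conn_inter_arm_le_acc_add_overhang _ x r
    _ = ∑ x ∈ box 3 r, (Pp (criticalProbI 3)).real (acc x ∩ arm r) +
          ∑ x ∈ box 3 r, (Pp (criticalProbI 3)).real ((conn x \ acc x) ∩ arm r) := Finset.sum_add_distrib
    _ ≤ CA * (r : ℝ) ^ ((11 : ℝ) / 4) * armProb (criticalProbI 3) r +
          CO * (r : ℝ) ^ ((11 : ℝ) / 4) * armProb (criticalProbI 3) r := add_le_add (hA r hr) (hO r hr)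
    _ = (CA + CO) * (r : ℝ) ^ ((11 : ℝ) / 4) * armProb (criticalProbI 3) r := by ring

/-- **COMPOSITION (kernel-checked modulo the two open stubs): the stubs imply the crux `TallClusterMassBound`, concluded
BY NAME.** `M(r) ≤ Σ P(acc x ∩ arm_r) + Σ P((conn x ∖ acc x) ∩ arm_r)`; the first sum is `≤ C r^{11/4} π_s(r)` by
`accessibleMass_le` (stubs 1–3), the second by `stub_overhangMassBound` (= landed glue theorem
`tallClusterMassBound_of_wallArmTwoSided_of_overhangMassBound` applied to the two open stubs). -/
theorem TallClusterMassBound_of : TallClusterMassBound := by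
  obtain ⟨CA, hA⟩ := accessibleMass_le
  obtain ⟨CO, hO⟩ := stub_overhangMassBound
  exact tallClusterMassBound_iff.2 (sk_massBoundAt_of_accessible_of_overhang hA hO)

end Summit.CriticalPhenomena.PercolationContinuityZ3.Cruxes.TallClusterMassBound.AccessibleSkeleton
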